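import Summits.BirchSwinnertonDyer.BirchSwinnertonDyer.Theorems.ManinLocalTwoThreeDegeneracyUnitTwistSquarefull
import Summits.BirchSwinnertonDyer.BirchSwinnertonDyer.Theorems.ManinLocalTwoThreeAdditiveOfSqDvdLevel
import Summits.BirchSwinnertonDyer.Rank1Residual.ManinAdditive.KatoCurveKPWitness
import Summits.BirchSwinnertonDyer.BirchSwinnertonDyer.Theorems.ManinLocalTwoThreeShimuraIndexKatz
import HarnessLib

/-!
# The KP witnesses at SQUAREFULL level `9 ∣ N` from the PROVED unit-twist theorems: E-es-87♭ BY NAME, E-es-87 / E-es-89 /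
# E-es-90 BY NAME under the crux's modularity binder, E-es-87± at `4 ∣ N`, and `3 ∤ c(W)` per Kosters–Pannekoek class
# modulo F₃♮ at `W` (`KatoFactThreeAtKP`)

Summit `BirchSwinnertonDyer`, route `ManinLocalTwoThree` (cell bsd-f2-manin), crux C3 `ManinPrimeToThreeAtNine`
(stmt-BirchSwinnertonDyer-22968).  This file hangs the W-level edges of es's leaf `…ManinAdditive.KatoCurveKPWitness` (typer
p664596; laws E-es-86/87/87♭/87♭⁺/87±/88/89/90 as `@[conjecture]` defs) on the tree THEOREMS of this seat
(`tameUnitTwistOfPlusIndexPrimeToThree` = E-es-87♭, `oddTameUnitTwistOfPlusIndexPrimeToThree_of_four_dvd` = E-es-87♭⁺|₄,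
`tamePolarUnitTwistOfDegeneracyNinePlusIndex` / `tameKPUnitTwistOfDegeneracyThreePlusIndex` = THEOREM U f-level,
`threeAdicPolarWitness_of_degeneracyNinePlusIndex`), as asked by the typer (INBOX 2026-08-28T20:30:32Z (i)):

* §1 `tameUnitTwistOfPlusIndexPrimeToThree_holds : TameUnitTwistOfPlusIndexPrimeToThree` — **E-es-87♭ BY NAME**.
* §2 (route-cone-free shape, `hadd` = additivity of `W` at `3`) `threeAdicKPWitness_of_plusIndexPrimeTo_of_kpZero` (ā = 0:
  the KP clause `χ(3)·0 ≠ 1` is empty), `threeAdicKPWitness_of_plusIndexPrimeTo_of_four_dvd_of_kp_ne_one` (ā ≠ +1, `4 ∣ N`: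
  odd order ⟹ `χ(3) ≠ −1`), `threeAdicKPWitness_of_degeneracyThreePlusIndex` (ā ≠ −1, ratio-`3` degeneracy plus index:
  `χ(3) ≠ 1`).
* §3 BY NAME under `exists_isNewformOf` (the crux's own fourth binder; it gives `N = N(W)`, hence additivity at `3` from
  `9 ∣ N`, `additive_at_three_of_nine_dvd_level`): **E-es-87** `threeAdicKPWitnessOfKPZeroSquarefull_of_exists_isNewformOf`,
  **E-es-90** `threeAdicPolarWitnessOfDegeneracyNinePlusIndex_of_exists_isNewformOf`, **E-es-89**
  `threeAdicKPWitnessOfDegeneracyThreePlusIndex_of_exists_isNewformOf`; E-es-87± at `4 ∣ N`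
  (`threeAdicKPWitness_of_four_dvd_of_kp_ne_one`); **E-es-66 on the squarefull locus ⟸ E-es-68₉**
  (`threeAdicPolarWitness_squarefull_of_degeneracyLoopLawNine`, via the leaf's `polarWitness_of_e90_of_lawNine`).
* §4 **`3 ∤ D.c` at COMPOSITE squarefull level** (a prime `q ≠ 3` with `q² ∣ N`), modulo F₃♮ at `W` (`KatoFactThreeAtKP W D.f`)
  and the binder `hnf`, per class: ā = 0 — NO law (`not_three_dvd_maninConstant_of_kpZero_squarefull`); ā ≠ +1 with `4 ∣ N` — NO
  law (`…_of_four_dvd_of_kp_ne_one_squarefull`); ā ≠ −1 — the f-specific ratio-`3` degeneracy plus index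
  (`…_of_degeneracyThreePlusIndex_squarefull`); every ā — E-es-68₉ (`…_of_degeneracyLoopLawNine_squarefull_kp`); and, with the
  LEAD's cusp lifting up to isogeny (`plusIndexPrimeTo_three_of_forall_isogeny_addOrderOf_ne`, Katz) in place of the second
  additive prime: ā = 0 / ā ≠ +1 ∧ `4 ∣ N` at ANY squarefull level for classes `3`-torsion-free up to `3`-isogeny
  (`…_of_forall_isogeny`).

HONEST FRAMING: CONDITIONAL on Kato's KP-indexed fact F₃♮ (Literature `def`, derived reading) and on modularity `hnf` (for
`N = N(W)`); the ā = +1 classes need the f-specific ratio-`3` index or the law E-es-68₉, the ā = −1 classes at odd `N` need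
B″ or E-es-68₉; non-squarefull levels are untouched.  C3, Manin's conjecture and BSD are NOT proved by this.  No definitions,
no named facts, no sorry.
-/

set_option linter.dupNamespace false
set_option autoImplicit false

noncomputable section

open scoped Classical MatrixGroups ModularForm ComplexConjugate

open CongruenceSubgroup Complex Literature.NumberTheory.EllipticCurves
  Literature.NumberTheory.EllipticCurves.ModularForms
  Summit.BirchSwinnertonDyer.Rank1Residual.ManinAdditive.Gamma1Lattice
  Summit.BirchSwinnertonDyer.Rank1Residual.ManinAdditive.KatoCurve

namespace Summit.BirchSwinnertonDyer.BirchSwinnertonDyer.Theorems.ManinLocalTwoThree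

/-! ### §1 E-es-87♭ BY NAME -/

/-- **E-es-87♭ `TameUnitTwistOfPlusIndexPrimeToThree` holds** (the leaf's law closed BY NAME by this seat's theorem
`tameUnitTwistOfPlusIndexPrimeToThree`, `…TameUnitTwist`). -/
theorem tameUnitTwistOfPlusIndexPrimeToThree_holds : TameUnitTwistOfPlusIndexPrimeToThree :=
  fun f hf hQ h3 hd ↦ tameUnitTwistOfPlusIndexPrimeToThree f hf hQ h3 hd

/-! ### §2 KP witnesses at squarefull level for `W` additive at `3` (route-cone-free shape) -/

section Witness

variable (W : WeierstrassCurve ℚ) [W.IsElliptic] {N : ℕ} [NeZero N] (D : ModularParametrizationData W N)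

omit [W.IsElliptic] [NeZero N] in
/-- At squarefull level the `N`-imprimitive Euler product over `ℓ ∥ N` is empty. -/
theorem primeFactors_filter_not_sq_dvd_eq_empty (hsq : IsSquarefull N) :
    (N.primeFactors.filter fun ℓ ↦ ¬ ℓ ^ 2 ∣ N) = ∅ :=
  Finset.filter_eq_empty_iff.mpr fun ℓ hℓ h ↦ h (hsq ℓ hℓ)

/-- **KP witness for ā = 0 (Kim–Nakamura locus) at squarefull level** from E-es-87♭: `W` additive at `3`, `9 ∣ N` squarefull,
`ā(W) = 0`, plus index prime to `3` ⟹ `ThreeAdicKPWitness W W D.f` (the clause `χ(3)·0 ≠ 1` is empty; ρ = 1; empty Euler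
product). -/
theorem threeAdicKPWitness_of_plusIndexPrimeTo_of_kpZero
    (hadd : ¬ W.HasGoodReductionAtPrime 3 ∧ ¬ W.HasMultiplicativeReductionAtPrime 3)
    (h9 : 3 ^ 2 ∣ N) (hsq : IsSquarefull N) (h0 : kpSignThree W = 0) (hpi : PlusIndexPrimeTo 3 D.f) :
    ThreeAdicKPWitness W W D.f := by
  have h3 : 3 ∣ N := dvd_trans (by norm_num) h9
  obtain ⟨m, hm, χ, r, hcop, hprim, hne, hord, hev, hr, hu⟩ :=
    tameUnitTwistOfPlusIndexPrimeToThree D.f D.isNewformOf.1 D.isNewformOf.coeffField_eq_bot h3 hpi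
  refine ⟨m, hm, χ, r, 1, D.isNewformOf, hadd.1, hadd.2, hcop, hprim, hne, hord, ?_, hev, by simp, ?_, ?_⟩
  · rw [h0, mul_zero]; exact zero_ne_one
  · rw [primeFactors_filter_not_sq_dvd_eq_empty hsq, Finset.prod_empty, one_mul, hr]
  · intro s hs
    have : (s : ℂ) * r * ((1 : ℚ) : ℂ) / 3 = (s : ℂ) * r / 3 := by push_cast; ring
    rw [this]
    exact hu s hs

/-- **KP witness for ā ≠ +1 at squarefull level `4 ∣ N`** from E-es-87♭⁺|₄: the twist has ODD order, so `χ(3) ≠ −1` and the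
Kosters–Pannekoek clause holds for `ā ∈ {0, −1}` (`mul_kpSignThree_ne_one_of_odd`). -/
theorem threeAdicKPWitness_of_plusIndexPrimeTo_of_four_dvd_of_kp_ne_one
    (hadd : ¬ W.HasGoodReductionAtPrime 3 ∧ ¬ W.HasMultiplicativeReductionAtPrime 3)
    (h9 : 3 ^ 2 ∣ N) (h4 : 4 ∣ N) (hsq : IsSquarefull N) (h1 : kpSignThree W ≠ 1) (hpi : PlusIndexPrimeTo 3 D.f) :
    ThreeAdicKPWitness W W D.f := by
  have h3 : 3 ∣ N := dvd_trans (by norm_num) h9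
  obtain ⟨m, hm, χ, r, hcop, hprim, hne, hodd, hord, hev, hr, hu⟩ :=
    oddTameUnitTwistOfPlusIndexPrimeToThree_of_four_dvd D.f D.isNewformOf.1 D.isNewformOf.coeffField_eq_bot h3 h4 hpi
  refine ⟨m, hm, χ, r, 1, D.isNewformOf, hadd.1, hadd.2, hcop, hprim, hne, hord,
    mul_kpSignThree_ne_one_of_odd χ W hodd h1, hev, by simp, ?_, ?_⟩
  · rw [primeFactors_filter_not_sq_dvd_eq_empty hsq, Finset.prod_empty, one_mul, hr]
  · intro s hs
    have : (s : ℂ) * r * ((1 : ℚ) : ℂ) / 3 = (s : ℂ) * r / 3 := by push_cast; ring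
    rw [this]
    exact hu s hs

/-- **KP witness for ā ≠ −1 at squarefull level from the ratio-`3` degeneracy plus index** (THEOREM U (a), E-es-89 shape):
the character is non-trivial on `⟨3̄⟩`, i.e. `χ(3) ≠ 1`, which is the Kosters–Pannekoek clause for `ā ∈ {0, +1}`. -/
theorem threeAdicKPWitness_of_degeneracyThreePlusIndex
    (hadd : ¬ W.HasGoodReductionAtPrime 3 ∧ ¬ W.HasMultiplicativeReductionAtPrime 3)
    (h9 : 3 ^ 2 ∣ N) (hsq : IsSquarefull N) (h1 : kpSignThree W ≠ -1) (hd3 : DegeneracyPlusIndexPrimeTo 3 3 D.f) :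
    ThreeAdicKPWitness W W D.f := by
  have h3 : 3 ∣ N := dvd_trans (by norm_num) h9
  obtain ⟨m, hm, χ, r, hcop, hprim, hne, hord, h3a, hev, hr, hu⟩ :=
    tameKPUnitTwistOfDegeneracyThreePlusIndex D.isNewformOf.1 D.isNewformOf.coeffField_eq_bot h3 hd3
  have hkp : χ (3 : ZMod m) * kpSignThree W ≠ 1 := by
    rcases kpSignThree_mem W with h | h | h
    · rw [h, mul_zero]; exact zero_ne_one
    · rw [h, mul_one]; exact h3a
    · exact absurd h h1
  refine ⟨m, hm, χ, r, 1, D.isNewformOf, hadd.1, hadd.2, hcop, hprim, hne, hord, hkp, hev, by simp, ?_, ?_⟩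
  · rw [primeFactors_filter_not_sq_dvd_eq_empty hsq, Finset.prod_empty, one_mul, hr]
  · intro s hs
    have : (s : ℂ) * r * ((1 : ℚ) : ℂ) / 3 = (s : ℂ) * r / 3 := by push_cast; ring
    rw [this]
    exact hu s hs

end Witness

/-! ### §3 The leaf's laws BY NAME under the crux binder `exists_isNewformOf` -/

/-- **E-es-87 `ThreeAdicKPWitnessOfKPZeroSquarefull` holds GIVEN modularity** (`N = N(W)` ⟹ `W` additive at `3`). -/
theorem threeAdicKPWitnessOfKPZeroSquarefull_of_exists_isNewformOf (hnf : exists_isNewformOf) :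
    ThreeAdicKPWitnessOfKPZeroSquarefull :=
  fun W _ _ _ _ D _ h9 hsq h0 hpi ↦
    threeAdicKPWitness_of_plusIndexPrimeTo_of_kpZero W D (additive_at_three_of_nine_dvd_level hnf D h9) h9 hsq h0 hpi

/-- **E-es-87± at `4 ∣ N` GIVEN modularity**: the KP witness for `ā(W) ≠ +1`, `9 ∣ N`, `4 ∣ N`, `N` squarefull, plus index
prime to `3` (the odd-`N` half of `ThreeAdicKPWitnessOfKPNeOneSquarefull` needs B″ and is not claimed). -/
theorem threeAdicKPWitness_of_four_dvd_of_kp_ne_one (hnf : exists_isNewformOf)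
    (W : WeierstrassCurve ℚ) [W.IsElliptic] {N : ℕ} [NeZero N] (D : ModularParametrizationData W N)
    (h9 : 3 ^ 2 ∣ N) (h4 : 4 ∣ N) (hsq : IsSquarefull N) (h1 : kpSignThree W ≠ 1) (hpi : PlusIndexPrimeTo 3 D.f) :
    ThreeAdicKPWitness W W D.f :=
  threeAdicKPWitness_of_plusIndexPrimeTo_of_four_dvd_of_kp_ne_one W D (additive_at_three_of_nine_dvd_level hnf D h9)
    h9 h4 hsq h1 hpi

/-- **E-es-90 `ThreeAdicPolarWitnessOfDegeneracyNinePlusIndex` holds GIVEN modularity** (THEOREM U (b) BY NAME). -/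
theorem threeAdicPolarWitnessOfDegeneracyNinePlusIndex_of_exists_isNewformOf (hnf : exists_isNewformOf) :
    ThreeAdicPolarWitnessOfDegeneracyNinePlusIndex :=
  fun W _ _ _ _ D _ h9 hsq hd ↦
    threeAdicPolarWitness_of_degeneracyNinePlusIndex W D (additive_at_three_of_nine_dvd_level hnf D h9) h9 hsq hd

/-- **E-es-89 `ThreeAdicKPWitnessOfDegeneracyThreePlusIndex` holds GIVEN modularity** (THEOREM U (a) BY NAME). -/
theorem threeAdicKPWitnessOfDegeneracyThreePlusIndex_of_exists_isNewformOf (hnf : exists_isNewformOf) :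
    ThreeAdicKPWitnessOfDegeneracyThreePlusIndex :=
  fun W _ _ _ _ D _ h9 hsq h1 hd3 ↦
    threeAdicKPWitness_of_degeneracyThreePlusIndex W D (additive_at_three_of_nine_dvd_level hnf D h9) h9 hsq h1 hd3

/-- **E-es-66 on the SQUAREFULL locus ⟸ E-es-68₉, GIVEN modularity** (in the shape of the law
`ThreeAdicWitnessOfPlusIndexPrimeToThree` plus `IsSquarefull N`): via the leaf's `polarWitness_of_e90_of_lawNine` and E-es-90
BY NAME. -/
theorem threeAdicPolarWitness_squarefull_of_degeneracyLoopLawNine (h68 : DegeneracyLoopLawNine)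
    (hnf : exists_isNewformOf) (W : WeierstrassCurve ℚ) [W.IsElliptic] [W.IsGloballyMinimal] {N : ℕ} [NeZero N]
    (D : ModularParametrizationData W N) (hopt : ∀ z ∈ D.L.lattice, ∃ w ∈ periodLattice D.f, z = D.c * w)
    (h9 : 3 ^ 2 ∣ N) (hsq : IsSquarefull N) (hpi : PlusIndexPrimeTo 3 D.f) : ThreeAdicPolarWitness W W D.f :=
  polarWitness_of_e90_of_lawNine (threeAdicPolarWitnessOfDegeneracyNinePlusIndex_of_exists_isNewformOf hnf) h68 W D hopt
    h9 hsq hpi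

/-! ### §4 `3 ∤ c(W)` at COMPOSITE squarefull level, per Kosters–Pannekoek class, modulo F₃♮ at `W` -/

/-- **ā = 0, NO law**: `3 ∤ c(W)` for every lattice-optimal `W` in the Kim–Nakamura class at a composite squarefull level
`9 ∣ N` (`q ≠ 3` prime, `q² ∣ N`), modulo F₃♮ at `W` and modularity. [cite: Kato2004Asterisque, Thm. 12.5 (1) (p. 221)] -/
theorem not_three_dvd_maninConstant_of_kpZero_squarefull (hnf : exists_isNewformOf)
    (W : WeierstrassCurve ℚ) [W.IsElliptic] [W.IsGloballyMinimal] {N : ℕ} [NeZero N]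
    (D : ModularParametrizationData W N) (hF : KatoFactThreeAtKP W D.f)
    (hopt : ∀ z ∈ D.L.lattice, ∃ w ∈ periodLattice D.f, z = D.c * w) (h9 : 3 ^ 2 ∣ N) (hsq : IsSquarefull N)
    (h0 : kpSignThree W = 0)
    {q : ℕ} (hq : q.Prime) (hq3 : q ≠ 3) (hqN : q ^ 2 ∣ N) : ¬ (3 : ℤ) ∣ D.c :=
  not_three_dvd_maninConstant_of_e87_of_kp (threeAdicKPWitnessOfKPZeroSquarefull_of_exists_isNewformOf hnf) W D hF hopt
    h9 hsq h0 hq hq3 hqN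

/-- **ā ≠ +1 with `4 ∣ N`, NO law**: `3 ∤ c(W)` at a composite squarefull level `36 ∣ N`, modulo F₃♮ at `W` and modularity.
[cite: Kato2004Asterisque, Thm. 12.5 (1) (p. 221)] -/
theorem not_three_dvd_maninConstant_of_four_dvd_of_kp_ne_one_squarefull (hnf : exists_isNewformOf)
    (W : WeierstrassCurve ℚ) [W.IsElliptic] [W.IsGloballyMinimal] {N : ℕ} [NeZero N]
    (D : ModularParametrizationData W N) (hF : KatoFactThreeAtKP W D.f)
    (hopt : ∀ z ∈ D.L.lattice, ∃ w ∈ periodLattice D.f, z = D.c * w) (h9 : 3 ^ 2 ∣ N) (hsq : IsSquarefull N)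
    (h4 : 4 ∣ N) (h1 : kpSignThree W ≠ 1)
    {q : ℕ} (hq : q.Prime) (hq3 : q ≠ 3) (hqN : q ^ 2 ∣ N) : ¬ (3 : ℤ) ∣ D.c := by
  have hΩ : W.realPeriodRat = ((|D.c| : ℤ) : ℝ) * plusPeriod D.f := by
    rw [Int.cast_abs]; exact D.realPeriodRat_eq_abs_mul_plusPeriod_of_latticeEq hopt
  have hc0 : D.c ≠ 0 := D.maninConstant_ne_zero_holds
  have hwit : ThreeAdicKPWitness W W D.f :=
    threeAdicKPWitness_of_four_dvd_of_kp_ne_one hnf W D h9 h4 hsq h1 (plusIndexPrimeTo_three_of_sq_dvd D hq hq3 hqN)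
  have h := not_three_dvd_of_katoFactThreeAtKP_of_kpWitness W W D.f |D.c| hF hwit hΩ (abs_ne_zero.mpr hc0)
  exact fun h3 ↦ h ((dvd_abs 3 D.c).mpr h3)

/-- **ā ≠ −1, from the f-specific ratio-`3` degeneracy plus index** (THEOREM U (a)): `3 ∤ c(W)` at squarefull level,
modulo F₃♮ at `W` and modularity. [cite: Kato2004Asterisque, Thm. 12.5 (1) (p. 221)] -/
theorem not_three_dvd_maninConstant_of_degeneracyThreePlusIndex_squarefull (hnf : exists_isNewformOf)
    (W : WeierstrassCurve ℚ) [W.IsElliptic] [W.IsGloballyMinimal] {N : ℕ} [NeZero N]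
    (D : ModularParametrizationData W N) (hF : KatoFactThreeAtKP W D.f)
    (hopt : ∀ z ∈ D.L.lattice, ∃ w ∈ periodLattice D.f, z = D.c * w) (h9 : 3 ^ 2 ∣ N) (hsq : IsSquarefull N)
    (h1 : kpSignThree W ≠ -1)
    (hd3 : DegeneracyPlusIndexPrimeTo 3 3 D.f) : ¬ (3 : ℤ) ∣ D.c :=
  not_three_dvd_maninConstant_of_e89_of_kp (threeAdicKPWitnessOfDegeneracyThreePlusIndex_of_exists_isNewformOf hnf) W D hF
    hopt h9 hsq h1 hd3

/-- **Every class, from E-es-68₉**: `3 ∤ c(W)` at a composite squarefull level `9 ∣ N`, modulo F₃♮ at `W`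
(`KatoFactThreeAtKP ⟹ KatoFactThreeAt`), the ratio-`9` degeneracy-loop law and modularity.
[cite: Kato2004Asterisque, Thm. 12.5 (1) (p. 221)] -/
theorem not_three_dvd_maninConstant_of_degeneracyLoopLawNine_squarefull_kp (hnf : exists_isNewformOf)
    (W : WeierstrassCurve ℚ) [W.IsElliptic] [W.IsGloballyMinimal] {N : ℕ} [NeZero N]
    (D : ModularParametrizationData W N) (hF : KatoFactThreeAtKP W D.f)
    (hopt : ∀ z ∈ D.L.lattice, ∃ w ∈ periodLattice D.f, z = D.c * w) (h9 : 3 ^ 2 ∣ N) (hsq : IsSquarefull N)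
    (h68 : DegeneracyLoopLawNine)
    {q : ℕ} (hq : q.Prime) (hq3 : q ≠ 3) (hqN : q ^ 2 ∣ N) : ¬ (3 : ℤ) ∣ D.c :=
  not_three_dvd_maninConstant_of_degeneracyLoopLawNine_squarefull h68 W D (katoFactThreeAt_of_kp W D.f hF)
    (additive_at_three_of_nine_dvd_level hnf D h9) hopt h9 hsq hq hq3 hqN

/-- **ā = 0, NO law, ANY squarefull level, class `3`-torsion-free up to `3`-isogeny**: the plus index is discharged by the
LEAD's cusp-lifting-up-to-isogeny theorem `plusIndexPrimeTo_three_of_forall_isogeny_addOrderOf_ne` (Ribet's Eisenstein property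
of `Σ(N)` + Katz 1981) instead of a second additive prime; so `3 ∤ c(W)` for every lattice-optimal `W` with `ā(W) = 0` at a
squarefull level `9 ∣ N` (pure powers of `3` included) none of whose `3`-isogenous curves has a rational point of order `3`,
modulo F₃♮ at `W` and modularity. [cite: Katz1980, Thm. 2 (m = ℓ)] -/
theorem not_three_dvd_maninConstant_of_kpZero_squarefull_of_forall_isogeny (hnf : exists_isNewformOf)
    (W : WeierstrassCurve ℚ) [W.IsElliptic] [W.IsGloballyMinimal] {N : ℕ} [NeZero N]
    (D : ModularParametrizationData W N) (hF : KatoFactThreeAtKP W D.f)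
    (hopt : ∀ z ∈ D.L.lattice, ∃ w ∈ periodLattice D.f, z = D.c * w) (h9 : 3 ^ 2 ∣ N) (hsq : IsSquarefull N)
    (h0 : kpSignThree W = 0)
    (hiso : ∀ (W' : WeierstrassCurve ℚ) [W'.IsElliptic] (g : WeierstrassCurve.Isogeny W W'), g.degree ∣ 3 →
      ∀ Q : W'.toAffine.Point, addOrderOf Q ≠ 3) : ¬ (3 : ℤ) ∣ D.c := by
  have hΩ : W.realPeriodRat = ((|D.c| : ℤ) : ℝ) * plusPeriod D.f := by
    rw [Int.cast_abs]; exact D.realPeriodRat_eq_abs_mul_plusPeriod_of_latticeEq hopt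
  have hc0 : D.c ≠ 0 := D.maninConstant_ne_zero_holds
  have hwit : ThreeAdicKPWitness W W D.f :=
    threeAdicKPWitness_of_plusIndexPrimeTo_of_kpZero W D (additive_at_three_of_nine_dvd_level hnf D h9) h9 hsq h0
      (plusIndexPrimeTo_three_of_forall_isogeny_addOrderOf_ne W D.isNewformOf hiso)
  have h := not_three_dvd_of_katoFactThreeAtKP_of_kpWitness W W D.f |D.c| hF hwit hΩ (abs_ne_zero.mpr hc0)
  exact fun h3 ↦ h ((dvd_abs 3 D.c).mpr h3)

/-- **ā ≠ +1 with `4 ∣ N`, NO law, class `3`-torsion-free up to `3`-isogeny**: as above at squarefull levels `36 ∣ N`.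
[cite: Katz1980, Thm. 2 (m = ℓ)] -/
theorem not_three_dvd_maninConstant_of_four_dvd_of_kp_ne_one_squarefull_of_forall_isogeny (hnf : exists_isNewformOf)
    (W : WeierstrassCurve ℚ) [W.IsElliptic] [W.IsGloballyMinimal] {N : ℕ} [NeZero N]
    (D : ModularParametrizationData W N) (hF : KatoFactThreeAtKP W D.f)
    (hopt : ∀ z ∈ D.L.lattice, ∃ w ∈ periodLattice D.f, z = D.c * w) (h9 : 3 ^ 2 ∣ N) (hsq : IsSquarefull N)
    (h4 : 4 ∣ N)
    (h1 : kpSignThree W ≠ 1)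
    (hiso : ∀ (W' : WeierstrassCurve ℚ) [W'.IsElliptic] (g : WeierstrassCurve.Isogeny W W'), g.degree ∣ 3 →
      ∀ Q : W'.toAffine.Point, addOrderOf Q ≠ 3) : ¬ (3 : ℤ) ∣ D.c := by
  have hΩ : W.realPeriodRat = ((|D.c| : ℤ) : ℝ) * plusPeriod D.f := by
    rw [Int.cast_abs]; exact D.realPeriodRat_eq_abs_mul_plusPeriod_of_latticeEq hopt
  have hc0 : D.c ≠ 0 := D.maninConstant_ne_zero_holds
  have hwit : ThreeAdicKPWitness W W D.f :=
    threeAdicKPWitness_of_four_dvd_of_kp_ne_one hnf W D h9 h4 hsq h1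
      (plusIndexPrimeTo_three_of_forall_isogeny_addOrderOf_ne W D.isNewformOf hiso)
  have h := not_three_dvd_of_katoFactThreeAtKP_of_kpWitness W W D.f |D.c| hF hwit hΩ (abs_ne_zero.mpr hc0)
  exact fun h3 ↦ h ((dvd_abs 3 D.c).mpr h3)


end Summit.BirchSwinnertonDyer.BirchSwinnertonDyer.Theorems.ManinLocalTwoThree

end
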